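import Summits.BirchSwinnertonDyer.BirchSwinnertonDyer.Theorems.EisensteinPrimesTwoVariableKatzBranchReflectRigidity
import Literature.NumberTheory.EllipticCurves.DeShalit1987.KatzMeasureTwistedLines
import Summits.BirchSwinnertonDyer.Rank1Residual.X11b.FramePrincipalUnitPowers
import Literature.NumberTheory.EllipticCurves.Hida2010MuInvariant.AnticyclotomicKatzBranchMuInvariant
import HarnessLib

/-!
# The twisted parallel line of the ω-branch frame IS the reflected `ψ`-line: equal reductions
# modulo `𝔪`, and the order/unit-content transfer to the `ℤ_p`-forms `g_φ(S=0)`, `g_ψ(S=0)`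
# (analytic junction (J) of road R-ψ for [BRω]; helper for crux 2 `GoodLatticeBDPValue`,
# stmt-BirchSwinnertonDyer-19032, cell `bsd-eis` seat `bsd-eis-k5-c2`)

HOME/k5-ty-g8/BR-OMEGA-ROAD.md §2 (e)–(g) / HOME/k5-c2-MEMO-6.md ADDENDUM (3). Let `G_φ` be the
two-variable de Shalit frame of `λ_φ = φ_K⁻¹` at the inverse generators of a pair `(κ, κ'; γ, γ')`
(`κ` anticyclotomic), `η` a twist with `λ_φ η = (ψ_K⁻¹)̌ ` whose avatar `r_η` factors through the pair
with values in `1 + 𝔪`, and `Ǧ` a one-variable `κ`-branch of `(ψ_K⁻¹)̌ ` at `γ⁻¹` (the reflected slice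
delivered by de Shalit's functional equation). Then:

* `map_residue_line_eq_of_omegaTwist` — **`G_φ(T, 0) ≡ Ǧ(T) (mod 𝔪)`**: the twisted parallel line
  `P = unitTwist (lineSubst a G_φᵗ) u`, `u = r_η(γ⁻¹)`, `1 + a = r_η(γ'⁻¹)`, is a `κ`-branch of
  `λ_φη = (ψ_K⁻¹)̌ ` (`IsKatzMeasure₂.isKatzBranch_unitTwist_lineSubst`, k5-ty p489040), hence EQUALS `Ǧ`
  (rigidity `isKatzBranch_reflect_inv_ext_inv`, p492539), and `P ≡ G_φ(T,0) (mod 𝔪)`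
  (`map_residue_unitTwist_lineSubst_transpose`).
* `order_eq_of_forall_coeff_eq_zero_iff`, `order_eq_of_associated`,
  `order_map_residue_map_eq` — bookkeeping: associated series over a domain have the same order;
  the reduction of `g ∈ ℤ_p⟦T⟧` and of its image under a structure map `J : ℤ_p → 𝒪_{ℂ_p}` have the
  same order (`𝔽_p ↪ 𝒪_{ℂ_p}/𝔪`).
* **`order_residue_eq_of_omegaTwist`** — (J): if moreover `J(g_φ(·,0)) ~ G_φ(·,0)`,
  `J(g_ψ(·,0)) ~ G_ψ(·,0)` and `Ǧ ~ G_ψ(·,0)` (the slice unit relation of (F),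
  `associated_of_relation`), then `g_φ(S=0) mod p` and `g_ψ(S=0) mod p` have the SAME ORDER in
  `𝔽_p⟦T⟧` — in particular the same vanishing: CGLS (2.16) "`λ(𝓛_ψ) = λ(𝓛_φ)`" for Rubin's
  `ℤ_p`-forms, in the kernel.

HONEST FRAMING: unconditional (the inputs `G_φ`, `Ǧ`, the unit relations are hypotheses supplied by
the typed facts in the assembly); no fact, no definition, no `sorry`; closes nothing by itself.
References: de Shalit 1987 II.4.17 (52)–(54), II.6.4; CGLS 2022 proof of Thm. 2.2.2 (2.16);
Greenberg–Vatsal 2000 p. 2 (1)–(2); Cassels 1986 Ch. 4 Thm. 4.1 (Strassmann); KY 2024 Thm. 1.2.2.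
-/

-- the summit namespace `Summit.BirchSwinnertonDyer.BirchSwinnertonDyer` repeats the problem name by design (D-0017)
set_option linter.dupNamespace false
set_option autoImplicit false

noncomputable section

open scoped Classical Topology

open Filter NumberField IsDedekindDomain Field Literature.NumberTheory.EllipticCurves
  Literature.NumberTheory.GaloisRepresentations Literature.NumberTheory.GaloisRepresentations.HeckeCharacter
  Literature.NumberTheory.EllipticCurves.Hida2010MuInvariant
  Summit.BirchSwinnertonDyer.Rank1Residual.X11b Summit.BirchSwinnertonDyer.Rank1Residual.X11b.Three.LambdaSupply

namespace Summit.BirchSwinnertonDyer.BirchSwinnertonDyer.Theorems.IwasawaTwoVariable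

/-! ## §1 Orders of power series: associated series, and reduction along a structure map -/

section Order

/-- Two power series (over possibly different semirings) whose coefficients vanish at the same indices
have the same order. [folklore] -/
theorem order_eq_of_forall_coeff_eq_zero_iff {R S : Type*} [Semiring R] [Semiring S]
    {f : PowerSeries R} {g : PowerSeries S}
    (h : ∀ n : ℕ, PowerSeries.coeff n f = 0 ↔ PowerSeries.coeff n g = 0) : f.order = g.order := by
  by_cases hf : f = 0
  · have hg : g = 0 := by
      ext n
      rw [map_zero]
      exact (h n).mp (by rw [hf, map_zero])
    rw [hf, hg, PowerSeries.order_zero, PowerSeries.order_zero]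
  · have hg : g ≠ 0 := fun hg ↦ hf (by
      ext n
      rw [map_zero]
      exact (h n).mpr (by rw [hg, map_zero]))
    have hfo : ((f.order.toNat : ℕ) : ℕ∞) = f.order :=
      ENat.coe_toNat (by rwa [Ne, PowerSeries.order_eq_top])
    have hgo : ((g.order.toNat : ℕ) : ℕ∞) = g.order :=
      ENat.coe_toNat (by rwa [Ne, PowerSeries.order_eq_top])
    apply le_antisymm
    · rw [← hgo]
      exact PowerSeries.order_le _ (fun h0 ↦ PowerSeries.coeff_order hg ((h _).mp h0))
    · rw [← hfo]
      exact PowerSeries.order_le _ (fun h0 ↦ PowerSeries.coeff_order hf ((h _).mpr h0))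

/-- Associated power series over a domain have the same order (a unit has order `0`). [folklore] -/
theorem order_eq_of_associated {R : Type*} [CommRing R] [IsDomain R] {f g : PowerSeries R}
    (h : Associated f g) : f.order = g.order := by
  obtain ⟨u, rfl⟩ := h
  have hu : PowerSeries.order (u : PowerSeries R) = 0 := by
    have h1 : IsUnit (PowerSeries.constantCoeff (u : PowerSeries R)) :=
      PowerSeries.isUnit_constantCoeff _ u.isUnit
    have h2 : PowerSeries.coeff 0 (u : PowerSeries R) ≠ 0 := by
      rw [PowerSeries.coeff_zero_eq_constantCoeff]
      exact h1.ne_zero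
    have h3 := PowerSeries.order_le 0 h2
    exact le_antisymm (by exact_mod_cast h3) zero_le
  rw [PowerSeries.order_mul, hu, add_zero]

variable {p : ℕ} [Fact p.Prime]

/-- **A coefficient of `g ∈ ℤ_p⟦T⟧` reduces to `0` iff its image under a structure map
`J : ℤ_p → 𝒪_{ℂ_p}` does** (both say: norm `< 1`). [cite: GreenbergVatsal2000, p. 2, (1)–(2)] -/
theorem residue_map_eq_zero_iff {J : ℤ_[p] →+* 𝓞_ℂ_[p]}
    (hJ : ∀ x : ℤ_[p], ((J x : 𝓞_ℂ_[p]) : ℂ_[p]) = ((x : ℚ_[p]) : ℂ_[p])) (x : ℤ_[p]) :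
    IsLocalRing.residue 𝓞_ℂ_[p] (J x) = 0 ↔ IsLocalRing.residue ℤ_[p] x = 0 := by
  rw [IsLocalRing.residue_eq_zero_iff, IsLocalRing.residue_eq_zero_iff, IsLocalRing.mem_maximalIdeal,
    IsLocalRing.mem_maximalIdeal, mem_nonunits_iff, mem_nonunits_iff, isUnit_padicComplexInt_iff, hJ,
    PadicComplex.norm_extends' p, PadicInt.padic_norm_e_of_padicInt, PadicInt.isUnit_iff]

/-- **Reduction commutes with the structure map, at the level of orders**: for `g ∈ ℤ_p⟦T⟧` and a
structure map `J : ℤ_p → 𝒪_{ℂ_p}`, the order of `g mod p` in `𝔽_p⟦T⟧` equals the order of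
`J(g) mod 𝔪` in `(𝒪_{ℂ_p}/𝔪)⟦T⟧`. [cite: GreenbergVatsal2000, p. 2, (1)–(2)] -/
theorem order_map_residue_map_eq {J : ℤ_[p] →+* 𝓞_ℂ_[p]}
    (hJ : ∀ x : ℤ_[p], ((J x : 𝓞_ℂ_[p]) : ℂ_[p]) = ((x : ℚ_[p]) : ℂ_[p])) (g : PowerSeries ℤ_[p]) :
    ((PowerSeries.map J g).map (IsLocalRing.residue 𝓞_ℂ_[p])).order =
      (g.map (IsLocalRing.residue ℤ_[p])).order :=
  order_eq_of_forall_coeff_eq_zero_iff fun n ↦ by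
    rw [PowerSeries.coeff_map, PowerSeries.coeff_map, PowerSeries.coeff_map]
    exact residue_map_eq_zero_iff hJ _

end Order

/-! ## §2 The twisted parallel line of `G_φ` is the reflected `ψ`-line: equal reductions -/

section Twist

variable {K : Type} [Field K] [NumberField K] [IsCMField K] {p : ℕ} [Fact p.Prime]

omit [NumberField K] [IsCMField K] in
/-- `‖x⁻¹ − 1‖ < 1` when `‖x − 1‖ < 1` in `ℂ_p`. [folklore] -/
theorem norm_inv_sub_one_lt {x : ℂ_[p]} (hx : ‖x - 1‖ < 1) : ‖x⁻¹ - 1‖ < 1 := by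
  have h1 : ‖x‖ = 1 := R1.norm_eq_one_of_norm_sub_one_lt hx
  have hx0 : x ≠ 0 := fun h ↦ by rw [h, norm_zero] at h1; exact zero_ne_one h1
  have e : x⁻¹ - 1 = -(x⁻¹ * (x - 1)) := by field_simp; ring
  rw [e, norm_neg, norm_mul, norm_inv, h1, inv_one, one_mul]
  exact hx

omit [IsCMField K] in
/-- The avatar of a character through `κ` is congruent to `1` at the INVERSE generator too:
`‖r(γ⁻¹) − 1‖ < 1`. [cite: deShalit1987, II.4.17 (52) (store chunk 77)] -/
theorem norm_avatarValueAt_inv_sub_one_lt {κ : ZpExtension K p} {γ : absoluteGaloisGroup K}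
    (hγ : κ.IsTopGenerator γ) {r : FramedGaloisRep K (PadicAlgCl p) 1} (hr : FactorsThroughZp κ r) :
    ‖avatarValueAt r γ⁻¹ - 1‖ < 1 := by
  have h := Halves.norm_avatarValueAt_sub_one_lt hγ hr
  have hmul : avatarValueAt r γ * avatarValueAt r γ⁻¹ = 1 := by
    rw [← avatarValueAt_mul, mul_inv_cancel, avatarValueAt_one]
  rw [eq_inv_of_mul_eq_one_right hmul]
  exact norm_inv_sub_one_lt h

/-- **The `κ`-line of the ω-branch frame and the reflected `ψ`-line agree modulo `𝔪`.** `K` imaginary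
quadratic, `p` odd, `(κ, κ'; γ, γ')` a generator pair with `κ` anticyclotomic; `ψ_K` finite-order,
`c`-invariant, unramified off `S`; `G_φ` a two-variable frame of `λ_φ` at `(γ⁻¹, γ'⁻¹)`; a twist `η`,
unramified away from `p`, with `λ_φη = (ψ_K⁻¹)̌ ` and rank-one avatar `e∘r_η` through the pair, congruent
to `1`; `Ǧ` a `κ`-branch of `(ψ_K⁻¹)̌ ` at `γ⁻¹` (same periods). Then
`G_φ(T, 0) ≡ Ǧ(T) (mod 𝔪_{𝒪_{ℂ_p}})` coefficientwise: the twisted parallel line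
`unitTwist (lineSubst a G_φᵗ) u` (`u = r_η(γ⁻¹)`, `1 + a = r_η(γ'⁻¹)`) is a `κ`-branch of `(ψ_K⁻¹)̌ `
(de Shalit II.4.17 (52)), equal to `Ǧ` by rigidity on the anticyclotomic line, and congruent to
`G_φ(T,0)`. CGLS (2.16) "the functional equation … yields `λ(𝓛_ψ) = λ(𝓛_φ)`", read on de Shalit frames.
[cite: deShalit1987, II.4.17 (52)–(54) (store chunk 77–78)]
[cite: CastellaGrossiLeeSkinner2022, proof of Thm. 2.2.2, (2.16)] [cite: Cassels1986, Ch. 4 Thm. 4.1] -/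
theorem map_residue_line_eq_of_omegaTwist (hp2 : p ≠ 2) (hK : IsImaginaryQuadratic K)
    (ι : PadicAlgCl p ≃+* ℂ) {v vbar : HeightOneSpectrum (𝓞 K)} {S : Finset (HeightOneSpectrum (𝓞 K))}
    {κ κ' : ZpExtension K p} (hκ : κ.IsAnticyclotomic) {γ γ' : absoluteGaloisGroup K}
    (hγ : κ.IsTopGenerator γ) (hpair : ZpExtension.IsTopGeneratorPair κ κ' γ γ')
    {ψK : HeckeCharacter K} (hfin : ψK.IsFiniteOrder)
    (hgal : HeckeCharacter.galConj (IsCMField.complexConj K) ψK = ψK)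
    (hunrψ : ∀ w : HeightOneSpectrum (𝓞 K), w ∉ S → ψK.IsUnramifiedAt w)
    {lamφ η : HeckeCharacter K} (hlamη : lamφ * η = DeShalit1987.reflect ψK⁻¹)
    (hηunr : ∀ w : HeightOneSpectrum (𝓞 K), ((p : ℕ) : 𝓞 K) ∉ w.asIdeal → η.IsUnramifiedAt w)
    {rη : absoluteGaloisGroup K →ₜ* (PadicAlgCl p)ˣ}
    (havη : IsPAdicAvatarOf ι η ((FramedRep.unitsContinuousMulEquivOfUnique (Fin 1) (PadicAlgCl p) :
      (PadicAlgCl p)ˣ →ₜ* GL (Fin 1) (PadicAlgCl p)).comp rη))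
    (hpairη : FactorsThroughPair κ κ' ((FramedRep.unitsContinuousMulEquivOfUnique (Fin 1) (PadicAlgCl p) :
      (PadicAlgCl p)ˣ →ₜ* GL (Fin 1) (PadicAlgCl p)).comp rη))
    (hη1 : ∀ σ : absoluteGaloisGroup K,
      ‖avatarValueAt ((FramedRep.unitsContinuousMulEquivOfUnique (Fin 1) (PadicAlgCl p) :
        (PadicAlgCl p)ˣ →ₜ* GL (Fin 1) (PadicAlgCl p)).comp rη) σ - 1‖ < 1)
    {Ω δ : ℂ} {Ωp : ℂ_[p]} {Gφ : PowerSeries (PowerSeries 𝓞_ℂ_[p])}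
    (hGφ : IsKatzMeasure₂ ι v vbar S κ κ' γ⁻¹ γ'⁻¹ lamφ Ω δ Ωp Gφ)
    {Gc : PowerSeries 𝓞_ℂ_[p]}
    (hGc : DeShalit1987.IsKatzBranch ι v vbar S κ γ⁻¹ (DeShalit1987.reflect ψK⁻¹) Ω δ Ωp Gc) :
    (PowerSeries.map (PowerSeries.constantCoeff (R := 𝓞_ℂ_[p])) Gφ).map (IsLocalRing.residue 𝓞_ℂ_[p]) =
      Gc.map (IsLocalRing.residue 𝓞_ℂ_[p]) := by
  set e := (FramedRep.unitsContinuousMulEquivOfUnique (Fin 1) (PadicAlgCl p) :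
    (PadicAlgCl p)ˣ →ₜ* GL (Fin 1) (PadicAlgCl p)) with he
  -- the evaluation points `u = r_η(γ⁻¹) ∈ 1 + 𝔪`, `a = r_η(γ'⁻¹) − 1 ∈ 𝔪`
  have hle : ∀ σ, ‖avatarValueAt (e.comp rη) σ‖ ≤ 1 := fun σ ↦
    (R1.norm_eq_one_of_norm_sub_one_lt (hη1 σ)).le
  set u : 𝓞_ℂ_[p] := ⟨avatarValueAt (e.comp rη) γ⁻¹, mem_padicComplexInt_iff.mpr (hle _)⟩ with hu_def
  have ha_mem : ‖avatarValueAt (e.comp rη) γ'⁻¹ - 1‖ ≤ 1 := (hη1 _).le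
  set a : 𝓞_ℂ_[p] := ⟨avatarValueAt (e.comp rη) γ'⁻¹ - 1, mem_padicComplexInt_iff.mpr ha_mem⟩ with ha_def
  have hu : ‖(u : ℂ_[p]) - 1‖ < 1 := hη1 γ⁻¹
  have ha : ‖(a : ℂ_[p])‖ < 1 := hη1 γ'⁻¹
  have hκγ' : κ γ'⁻¹ = 1 := by rw [map_inv, hpair.apply_right, inv_one]
  -- point transport along `η`
  have hpt : ∀ (ρ : HeckeCharacter K) (r : FramedGaloisRep K (PadicAlgCl p) 1),
      IsPAdicAvatarOf ι ρ r → FactorsThroughZp κ r →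
      ∃ r' : FramedGaloisRep K (PadicAlgCl p) 1,
        IsPAdicAvatarOf ι (η * ρ) r' ∧ FactorsThroughPair κ κ' r' ∧
          avatarValueAt r' γ⁻¹ = (u : ℂ_[p]) * avatarValueAt r γ⁻¹ ∧
          avatarValueAt r' γ'⁻¹ = 1 + (a : ℂ_[p]) := by
    intro ρ r hr hκr
    set r₀ : absoluteGaloisGroup K →ₜ* (PadicAlgCl p)ˣ :=
      ((FramedRep.unitsContinuousMulEquivOfUnique (Fin 1) (PadicAlgCl p)).symm :
        GL (Fin 1) (PadicAlgCl p) →ₜ* (PadicAlgCl p)ˣ).comp r with hr₀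
    have hr' : e.comp r₀ = r := comp_symm_comp_eq r
    have hr2 : IsPAdicAvatarOf ι ρ (e.comp r₀) := by rw [hr']; exact hr
    have hκr2 : FactorsThroughZp κ (e.comp r₀) := by rw [hr']; exact hκr
    have hram : ∀ w : HeightOneSpectrum (𝓞 K), ((p : ℕ) : 𝓞 K) ∉ w.asIdeal →
        (η * ρ).IsUnramifiedAt w → η.IsUnramifiedAt w ∧ ρ.IsUnramifiedAt w := fun w hw h ↦
      ⟨hηunr w hw, by
        have h1 := (hηunr w hw).inv'.mul' h
        rwa [← mul_assoc, inv_mul_cancel, one_mul] at h1⟩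
    refine ⟨e.comp (rη * r₀), isPAdicAvatarOf_mul ι havη hr2 hram, fun σ h1 h2 ↦ ?_, ?_, ?_⟩
    · -- through the pair
      have hη' : rη σ = 1 := by
        have h := hpairη σ h1 h2
        rw [ContinuousMonoidHom.coe_comp, Function.comp_apply] at h
        exact (map_eq_one_iff _ (FramedRep.unitsContinuousMulEquivOfUnique (Fin 1) (PadicAlgCl p)).injective).mp h
      have hr₀' : r₀ σ = 1 := ((factorsThroughZp_unitsChar_iff κ r₀).mp hκr2) σ h1
      rw [ContinuousMonoidHom.coe_comp, Function.comp_apply, ContinuousMonoidHom.mul_apply, hη', hr₀',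
        one_mul, map_one]
    · rw [avatarValueAt_unitsChar_mul, hr']
    · rw [avatarValueAt_unitsChar_mul, hr', avatarValueAt_eq_one_of_factorsThroughZp hκr hκγ', mul_one,
        ha_def]
      push_cast
      ring
  have hnorm : ∀ r : FramedGaloisRep K (PadicAlgCl p) 1, FactorsThroughZp κ r →
      ‖avatarValueAt r γ⁻¹ - 1‖ < 1 := fun r hr ↦ norm_avatarValueAt_inv_sub_one_lt hγ hr
  -- the twisted parallel line is a branch of `λ_φ η = reflect ψ_K⁻¹`
  have hH := hGφ.isKatzBranch_unitTwist_lineSubst ha hu hpt hnorm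
  rw [hlamη] at hH
  -- rigidity on the anticyclotomic line, then reduction modulo `𝔪`
  have heq := isKatzBranch_reflect_inv_ext_inv hp2 hK hκ hγ hfin hgal hunrψ hH hGc
  rw [← heq, IntSeries.map_residue_unitTwist_lineSubst_transpose Gφ ha hu]

end Twist

/-! ## §3 (J): the `ℤ_p`-forms `g_φ(S=0)`, `g_ψ(S=0)` have the same order modulo `p` -/

section Junction

variable {p : ℕ} [Fact p.Prime]

/-- **(J) — order and unit content transfer between the two branches.** If `G_φ(·,0) ≡ Ǧ (mod 𝔪)`
(§2), `Ǧ ~ G_ψ(·,0)` (the unit relation of de Shalit's functional equation on the anticyclotomic line,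
`associated_of_relation`), and `J(g_φ(·,0)) ~ G_φ(·,0)`, `J(g_ψ(·,0)) ~ G_ψ(·,0)` for the `ℤ_p`-forms
`g_φ, g_ψ` of Rubin's two-variable main conjecture and a structure map `J`, then
`ord(g_φ(S=0) mod p) = ord(g_ψ(S=0) mod p)` in `𝔽_p⟦T⟧` (orders are invariant under units, and
reduction commutes with `J` at the level of orders). Consequently `g_φ(S=0) mod p ≠ 0` iff
`g_ψ(S=0) mod p ≠ 0`, and the analytic `λ` of the ω-branch IS the `n₁` of the `𝟙̃`-branch.
[cite: CastellaGrossiLeeSkinner2022, proof of Thm. 2.2.2, (2.16)] [cite: GreenbergVatsal2000, p. 2, (1)–(2)]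
[cite: KellerYin2024, Thm. 1.2.2 and proof of Thm. 2.2.3 (arXiv:2402.12781v2 TeX L1450–1468)] -/
theorem order_residue_eq_of_omegaTwist {J : ℤ_[p] →+* 𝓞_ℂ_[p]}
    (hJ : ∀ x : ℤ_[p], ((J x : 𝓞_ℂ_[p]) : ℂ_[p]) = ((x : ℚ_[p]) : ℂ_[p]))
    {Gφ Gψ : PowerSeries (PowerSeries 𝓞_ℂ_[p])} {Gc : PowerSeries 𝓞_ℂ_[p]} {gφ gψ : IwasawaAlgebra₂ p}
    (hred : (PowerSeries.map (PowerSeries.constantCoeff (R := 𝓞_ℂ_[p])) Gφ).map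
        (IsLocalRing.residue 𝓞_ℂ_[p]) = Gc.map (IsLocalRing.residue 𝓞_ℂ_[p]))
    (hc : Associated Gc (PowerSeries.map (PowerSeries.constantCoeff (R := 𝓞_ℂ_[p])) Gψ))
    (hφ : Associated (PowerSeries.map (PowerSeries.map J) gφ) Gφ)
    (hψ : Associated (PowerSeries.map (PowerSeries.map J) gψ) Gψ) :
    ((gφ.map (PowerSeries.constantCoeff (R := ℤ_[p]))).map (IsLocalRing.residue ℤ_[p])).order =
      ((gψ.map (PowerSeries.constantCoeff (R := ℤ_[p]))).map (IsLocalRing.residue ℤ_[p])).order := by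
  -- read the two-variable unit relations on the inner line `S = 0`
  have e : ∀ g : IwasawaAlgebra₂ p,
      PowerSeries.map (PowerSeries.constantCoeff (R := 𝓞_ℂ_[p])) (PowerSeries.map (PowerSeries.map J) g) =
        PowerSeries.map J (g.map (PowerSeries.constantCoeff (R := ℤ_[p]))) := fun g ↦ by
    ext n
    simp only [PowerSeries.coeff_map, ← PowerSeries.coeff_zero_eq_constantCoeff_apply]
  have hφ' : Associated (PowerSeries.map J (gφ.map (PowerSeries.constantCoeff (R := ℤ_[p]))))
      (PowerSeries.map (PowerSeries.constantCoeff (R := 𝓞_ℂ_[p])) Gφ) := by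
    rw [← e]; exact hφ.map (PowerSeries.map (PowerSeries.constantCoeff (R := 𝓞_ℂ_[p])))
  have hψ' : Associated (PowerSeries.map J (gψ.map (PowerSeries.constantCoeff (R := ℤ_[p]))))
      (PowerSeries.map (PowerSeries.constantCoeff (R := 𝓞_ℂ_[p])) Gψ) := by
    rw [← e]; exact hψ.map (PowerSeries.map (PowerSeries.constantCoeff (R := 𝓞_ℂ_[p])))
  -- reduce modulo `𝔪` (a field), where associated series have equal orders
  letI : Field (IsLocalRing.ResidueField 𝓞_ℂ_[p]) := inferInstance
  have h1 := order_eq_of_associated (hφ'.map (PowerSeries.map (IsLocalRing.residue 𝓞_ℂ_[p])))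
  have h2 := order_eq_of_associated (hψ'.map (PowerSeries.map (IsLocalRing.residue 𝓞_ℂ_[p])))
  have h3 := order_eq_of_associated (hc.map (PowerSeries.map (IsLocalRing.residue 𝓞_ℂ_[p])))
  rw [← order_map_residue_map_eq hJ, ← order_map_residue_map_eq hJ, h1, h2, hred, h3]

/-- **(J), vanishing form**: under the hypotheses of `order_residue_eq_of_omegaTwist`,
`g_φ(S=0) mod p ≠ 0 ↔ g_ψ(S=0) mod p ≠ 0`. [cite: CastellaGrossiLeeSkinner2022, proof of Thm. 2.2.2, (2.16)] -/
theorem map_residue_ne_zero_iff_of_omegaTwist {J : ℤ_[p] →+* 𝓞_ℂ_[p]}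
    (hJ : ∀ x : ℤ_[p], ((J x : 𝓞_ℂ_[p]) : ℂ_[p]) = ((x : ℚ_[p]) : ℂ_[p]))
    {Gφ Gψ : PowerSeries (PowerSeries 𝓞_ℂ_[p])} {Gc : PowerSeries 𝓞_ℂ_[p]} {gφ gψ : IwasawaAlgebra₂ p}
    (hred : (PowerSeries.map (PowerSeries.constantCoeff (R := 𝓞_ℂ_[p])) Gφ).map
        (IsLocalRing.residue 𝓞_ℂ_[p]) = Gc.map (IsLocalRing.residue 𝓞_ℂ_[p]))
    (hc : Associated Gc (PowerSeries.map (PowerSeries.constantCoeff (R := 𝓞_ℂ_[p])) Gψ))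
    (hφ : Associated (PowerSeries.map (PowerSeries.map J) gφ) Gφ)
    (hψ : Associated (PowerSeries.map (PowerSeries.map J) gψ) Gψ) :
    (gφ.map (PowerSeries.constantCoeff (R := ℤ_[p]))).map (IsLocalRing.residue ℤ_[p]) ≠ 0 ↔
      (gψ.map (PowerSeries.constantCoeff (R := ℤ_[p]))).map (IsLocalRing.residue ℤ_[p]) ≠ 0 := by
  have h := order_residue_eq_of_omegaTwist hJ hred hc hφ hψ
  rw [Ne, Ne, ← PowerSeries.order_eq_top, ← PowerSeries.order_eq_top, h]

end Junction

end Summit.BirchSwinnertonDyer.BirchSwinnertonDyer.Theorems.IwasawaTwoVariable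

end
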